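import Summits.Ventures.CertifiedManyBodySolver.Theorems.M3x2EdgeSplitSymReplayGramRSyntax
import HarnessLib

/-!
# SymReplay gramR — semantics (a)–(e): letterwise moves, eigen-soundness, the block identity `P_B = |moves| • D_B + Σ uses` (module 2/4)
Text: hub-lb-sym-plan-1 g2 (`Cruxes/LowerEdge_ge_m83o100/SymReplayGramR_symplan1.lean` rev 3, a26d6b87249c), landed verbatim by hub-lb-sym-eng-3. No summit or crux statement is proved here; no certificate beyond toys is replayed; nothing here predicts superconductivity.
-/

noncomputable section

namespace Summit.Ventures.CertifiedManyBodySolver.Theorems.SymReplay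

open Matrix Finset
open Literature.MathematicalPhysics.QuantumLattice
open Literature.MathematicalPhysics.QuantumLattice.HubbardWave0
open Literature.MathematicalPhysics.QuantumLattice.ThermodynamicLimit
open Literature.Probability.LatticeModels
open Literature.MathematicalPhysics.QuantumManyBody.StateRelaxation
open Summit.Ventures.CertifiedManyBodySolver.Theorems.WardSlot
open scoped ComplexOrder BigOperators

/-! #### (a) Small list-sum helpers -/

/-- Helper: a list sum of sums splits. -/
theorem list_sum_map_flatMap {α β : Type*} {Λ' : Finset (Site 2)} (l : List α) (f : α → List β) (g : β → FermionOp Λ') :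
    ((l.flatMap f).map g).sum = (l.map fun a => ((f a).map g).sum).sum := by
  induction l with
  | nil => simp
  | cons a l ih => rw [List.flatMap_cons, List.map_append, List.sum_append, List.map_cons, List.sum_cons, ih]

/-- Helper: swapping a double list sum. -/
theorem list_sum_swap {α β M : Type*} [AddCommMonoid M] (l : List α) (ms : List β) (f : α → β → M) :
    (l.map fun a => (ms.map fun m => f a m).sum).sum = (ms.map fun m => (l.map fun a => f a m).sum).sum := by
  induction l with
  | nil => simp
  | cons a l ih => rw [List.map_cons, List.sum_cons, ih, ← List.sum_map_add]; rfl

/-- Helper: a constant list sum is a natural multiple. -/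
theorem list_sum_map_const {β M : Type*} [AddCommMonoid M] (ms : List β) (X : M) :
    (ms.map fun _ => X).sum = ms.length • X := by
  rw [List.map_const', List.sum_replicate]

/-- Helper: negation through a list sum. -/
theorem list_sum_map_neg {α : Type*} {Λ' : Finset (Site 2)} (l : List α) (f : α → FermionOp Λ') :
    (l.map fun a => -f a).sum = -(l.map f).sum := by
  induction l with
  | nil => simp
  | cons a l ih => rw [List.map_cons, List.sum_cons, List.map_cons, List.sum_cons, ih, neg_add]

/-! #### (b) List identities of the letterwise move `movePolyF` -/

/-- `movePolyF = movePolyW` (flattening is the identity). -/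
theorem movePolyF_eq (γ : DihedralGroup 4) (v : Site 2) (p : QPoly) : movePolyF γ v p = movePolyW γ v p := by
  simp only [movePolyF, movePolyW, moveWordF_eq]

/-- Helper `moveWordF_append'`. -/
theorem moveWordF_append' (γ : DihedralGroup 4) (v : Site 2) (u w : Word) :
    moveWordF γ v (u ++ w) = moveWordF γ v u ++ moveWordF γ v w := List.map_append

/-- Helper `moveWordF_adjWord`: the move commutes with the adjoint of a word. -/
theorem moveWordF_adjWord (γ : DihedralGroup 4) (v : Site 2) (u : Word) :
    moveWordF γ v (adjWord u) = adjWord (moveWordF γ v u) := by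
  simp only [moveWordF, adjWord, List.map_reverse, List.map_map]
  rfl

/-- Helper `movePolyF_pscale`. -/
theorem movePolyF_pscale (γ : DihedralGroup 4) (v : Site 2) (c : ℚ) (p : QPoly) :
    movePolyF γ v (pscale c p) = pscale c (movePolyF γ v p) := by
  simp only [movePolyF, pscale, List.map_map]
  rfl

/-- Helper `movePolyF_flatMap`. -/
theorem movePolyF_flatMap {α : Type*} (γ : DihedralGroup 4) (v : Site 2) (l : List α) (f : α → QPoly) :
    movePolyF γ v (l.flatMap f) = l.flatMap fun a => movePolyF γ v (f a) := by
  simp only [movePolyF, List.map_flatMap]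

/-- Helper `movePolyF_ite_nil`. -/
theorem movePolyF_ite_nil (γ : DihedralGroup 4) (v : Site 2) (c : Prop) [Decidable c] (p : QPoly) :
    movePolyF γ v (if c then [] else p) = if c then [] else movePolyF γ v p := by
  split_ifs <;> rfl

/-- Helper `movePolyF_padj`: the move commutes with the adjoint. -/
theorem movePolyF_padj (γ : DihedralGroup 4) (v : Site 2) (p : QPoly) :
    movePolyF γ v (padj p) = padj (movePolyF γ v p) := by
  simp only [movePolyF, padj, List.map_map, Function.comp_def, moveWordF_adjWord]

/-- Helper `movePolyF_pmul`: the move is multiplicative on word polynomials (letterwise, exact list identity). -/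
theorem movePolyF_pmul (γ : DihedralGroup 4) (v : Site 2) (p r : QPoly) :
    movePolyF γ v (pmul p r) = pmul (movePolyF γ v p) (movePolyF γ v r) := by
  simp only [movePolyF, pmul, List.map_flatMap, List.flatMap_map, List.map_map, Function.comp_def,
    moveWordF_append']

/-! #### (c) Operator lemmas: a moved polynomial differs from the original by identification uses -/

/-- The identification uses of moving every term of `p` by `(γ, v)`. -/
def polyUses (γ : DihedralGroup 4) (v : Site 2) (p : QPoly) : List IdUse := p.map fun t => ⟨t.1, t.2, γ, v⟩

/-- **Pure linearity**: `polyOp (α(p)) − polyOp p = Σ_{t ∈ p} useOp ⟨t.1, t.2, γ, v⟩` (no support hypothesis —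
`useOp` is literally `z • (wordOp (moveWord γ v u) − wordOp u)`). -/
theorem polyOp_movePolyF_sub (Λ' : Finset (Site 2)) (γ : DihedralGroup 4) (v : Site 2) (p : QPoly) :
    polyOp Λ' (movePolyF γ v p) - polyOp Λ' p = ((polyUses γ v p).map (useOp Λ')).sum := by
  induction p with
  | nil => simp [movePolyF, polyUses]
  | cons t p ih =>
    rw [movePolyF, List.map_cons, ← movePolyF, polyOp_cons, polyOp_cons, polyUses, List.map_cons, ← polyUses,
      List.map_cons, List.sum_cons, ← ih, moveWordF_eq, useOp, smul_sub]
    abel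

/-- Uses of a move have the moved terms' words. -/
theorem polyUses_u {γ : DihedralGroup 4} {v : Site 2} {p : QPoly} {e : IdUse} (he : e ∈ polyUses γ v p) :
    ∃ t ∈ p, e.u = t.2 := by
  rw [polyUses, List.mem_map] at he
  obtain ⟨t, ht, rfl⟩ := he
  exact ⟨t, ht, rfl⟩

/-- **Generated basis, semantics**: `polyOp (genOne ms s) = Σ_m χ_m • polyOp (α_m s)`. -/
theorem polyOp_genOne (Λ' : Finset (Site 2)) (ms : List RMove) (s : QPoly) (hs : PSupp (genPre ms s) Λ') :
    polyOp Λ' (genOne ms s) = (ms.map fun m => ((m.χ : ℚ) : ℂ) • polyOp Λ' (movePolyF m.γ m.v s)).sum := by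
  rw [genOne, polyOp_eq_evalP, collect_eval, ← polyOp_eq_evalP, polyOp_nfPoly stub_nfFaithful _ _ hs, genPre,
    polyOp_flatMap]
  simp only [polyOp_pscale]

/-- **Eigen-check, semantics**: a passing syntactic eigen-check gives `polyOp (α_m q) = χ_m • polyOp q`. -/
theorem eigen_sound (Λ' : Finset (Site 2)) (m : RMove) (q : QPoly) (hq : PSupp (movePolyF m.γ m.v q) Λ')
    (h : isZero (psub (nfPoly (movePolyF m.γ m.v q)) (pscale m.χ q)) = true) :
    polyOp Λ' (movePolyF m.γ m.v q) = ((m.χ : ℚ) : ℂ) • polyOp Λ' q := by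
  have h0 := polyOp_eq_zero_of_isZero Λ' _ h
  rwa [polyOp_psub, polyOp_nfPoly stub_nfFaithful _ _ hq, polyOp_pscale, sub_eq_zero] at h0

/-- From `eigenOK`: per move, support and the eigen identity. -/
theorem eigenOK_spec {frame : List (Site 2)} {ms : List RMove} {q : QPoly} (h : eigenOK frame ms q = true) :
    ∀ m ∈ ms, PSupp (movePolyF m.γ m.v q) frame.toFinset ∧
      isZero (psub (nfPoly (movePolyF m.γ m.v q)) (pscale m.χ q)) = true := by
  intro m hm
  have h' := List.all_eq_true.1 h m hm
  rw [Bool.and_eq_true] at h'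
  exact ⟨PSupp_of_psuppIn h'.1, h'.2⟩

/-- Helper `padj_flatMap`. -/
theorem padj_flatMap {α : Type*} (l : List α) (f : α → QPoly) :
    padj (l.flatMap f) = l.flatMap fun a => padj (f a) := by
  simp only [padj, List.map_flatMap]

/-- Helper `padj_pscale`. -/
theorem padj_pscale (c : ℚ) (p : QPoly) : padj (pscale c p) = pscale c (padj p) := by
  simp only [padj, pscale, List.map_map]
  rfl

/-- Helper `pmul_flatMap_left`. -/
theorem pmul_flatMap_left {α : Type*} (l : List α) (f : α → QPoly) (r : QPoly) :
    pmul (l.flatMap f) r = l.flatMap fun a => pmul (f a) r := by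
  simp only [pmul, List.flatMap_assoc]

/-- Helper `pmul_pscale_left`. -/
theorem pmul_pscale_left (c : ℚ) (p r : QPoly) : pmul (pscale c p) r = pscale c (pmul p r) := by
  simp only [pmul, pscale, List.flatMap_map, List.map_flatMap, List.map_map, Function.comp_def, mul_assoc]

/-- **The pair identity**: `(q_a)† q_b = Σ_m α_m(s_a† q_b)` as operators, for `q_a` generated from `s_a` and `q_b`
passing the eigen-check for the same moves. -/
theorem polyOp_pair (Λ' : Finset (Site 2)) (ms : List RMove) (sa qb : QPoly) (hsa : PSupp (genPre ms sa) Λ')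
    (hqb : ∀ m ∈ ms, PSupp (movePolyF m.γ m.v qb) Λ' ∧
      isZero (psub (nfPoly (movePolyF m.γ m.v qb)) (pscale m.χ qb)) = true) :
    polyOp Λ' (pmul (padj (genOne ms sa)) qb) =
      (ms.map fun m => polyOp Λ' (movePolyF m.γ m.v (pmul (padj sa) qb))).sum := by
  have hG : polyOp Λ' (pmul (padj (genOne ms sa)) qb) = polyOp Λ' (pmul (padj (genPre ms sa)) qb) := by
    rw [polyOp_pmul, polyOp_pmul, polyOp_padj, polyOp_padj, polyOp_genOne Λ' ms sa hsa, genPre, polyOp_flatMap]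
    simp only [polyOp_pscale]
  rw [hG, genPre, padj_flatMap, pmul_flatMap_left, polyOp_flatMap]
  congr 1
  refine List.map_congr_left fun m hm => ?_
  obtain ⟨hq1, hq2⟩ := hqb m hm
  rw [padj_pscale, pmul_pscale_left, polyOp_pscale, polyOp_pmul, ← mul_smul_comm,
    ← eigen_sound Λ' m qb hq1 hq2, movePolyF_pmul, movePolyF_padj, polyOp_pmul]

/-! #### (d) The block identity `P_B = |moves| • D_B + Σ uses` -/

/-- The identification uses by which a block's expansion `P_B` exceeds `|moves| • D_B`. -/
def blockUses (B : GramBlockR) : List IdUse := B.moves.flatMap fun m => polyUses m.γ m.v (gramBlockPolyR B)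

/-- The expansion of an R-block, as a list: outer index over the representatives. -/
theorem gramBlockPoly_toGramBlock (B : GramBlockR) :
    gramBlockPoly (toGramBlock B) = pscale B.scale ((B.reps.zip B.rows).flatMap fun a =>
      ((genBasis B).zip B.rows).flatMap fun b =>
        if sdot a.2 b.2 = 0 then [] else pscale (sdot a.2 b.2) (pmul (padj (genOne B.moves a.1)) b.1)) := by
  unfold gramBlockPoly toGramBlock
  simp only [genBasis, List.zip_map_left, List.flatMap_map, Prod.map_fst, Prod.map_snd, id_eq]

/-- One ROW of the block: `Σ_b g_ab · q_a† q_b = Σ_m α_m(Σ_b g_ab · s_a† q_b)`. -/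
theorem polyOp_blockRow (Λ' : Finset (Site 2)) (B : GramBlockR) (a : QPoly × List (ℚ × ℕ))
    (hsa : PSupp (genPre B.moves a.1) Λ')
    (hq : ∀ q ∈ genBasis B, ∀ m ∈ B.moves, PSupp (movePolyF m.γ m.v q) Λ' ∧
      isZero (psub (nfPoly (movePolyF m.γ m.v q)) (pscale m.χ q)) = true) :
    polyOp Λ' (((genBasis B).zip B.rows).flatMap fun b =>
        if sdot a.2 b.2 = 0 then [] else pscale (sdot a.2 b.2) (pmul (padj (genOne B.moves a.1)) b.1)) =
      (B.moves.map fun m => polyOp Λ' (movePolyF m.γ m.v (((genBasis B).zip B.rows).flatMap fun b =>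
        if sdot a.2 b.2 = 0 then [] else pscale (sdot a.2 b.2) (pmul (padj a.1) b.1)))).sum := by
  simp only [movePolyF_flatMap, movePolyF_ite_nil, movePolyF_pscale]
  rw [polyOp_flatMap]
  simp only [polyOp_flatMap]
  rw [← list_sum_swap]
  congr 1
  refine List.map_congr_left fun b hb => ?_
  have hb1 : b.1 ∈ genBasis B := (List.of_mem_zip (by rw [Prod.mk.eta]; exact hb)).1
  split_ifs with hg
  · simp
  · rw [polyOp_pscale, polyOp_pair Λ' B.moves a.1 b.1 hsa (hq b.1 hb1), List.smul_sum, List.map_map]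
    congr 1
    refine List.map_congr_left fun m _ => ?_
    simp only [Function.comp, polyOp_pscale]

/-- **THE BLOCK IDENTITY.**  For an R-block whose representatives generate inside `Λ'` and whose generated basis
passes the eigen-check: `polyOp (gramBlockPoly (toGramBlock B)) = polyOp (|moves| • D_B) + Σ (blockUses B)`. -/
theorem polyOp_toGramBlock (Λ' : Finset (Site 2)) (B : GramBlockR)
    (hs : ∀ s ∈ B.reps, PSupp (genPre B.moves s) Λ')
    (hq : ∀ q ∈ genBasis B, ∀ m ∈ B.moves, PSupp (movePolyF m.γ m.v q) Λ' ∧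
      isZero (psub (nfPoly (movePolyF m.γ m.v q)) (pscale m.χ q)) = true) :
    polyOp Λ' (gramBlockPoly (toGramBlock B)) =
      polyOp Λ' (pscale (B.moves.length : ℚ) (gramBlockPolyR B)) + ((blockUses B).map (useOp Λ')).sum := by
  -- (1) `P_B = Σ_m polyOp (α_m D_B)`
  have h1 : polyOp Λ' (gramBlockPoly (toGramBlock B)) =
      (B.moves.map fun m => polyOp Λ' (movePolyF m.γ m.v (gramBlockPolyR B))).sum := by
    rw [gramBlockPoly_toGramBlock, polyOp_pscale, polyOp_flatMap]
    have hrow : ∀ a ∈ B.reps.zip B.rows,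
        polyOp Λ' (((genBasis B).zip B.rows).flatMap fun b =>
          if sdot a.2 b.2 = 0 then [] else pscale (sdot a.2 b.2) (pmul (padj (genOne B.moves a.1)) b.1)) =
        (B.moves.map fun m => polyOp Λ' (movePolyF m.γ m.v (((genBasis B).zip B.rows).flatMap fun b =>
          if sdot a.2 b.2 = 0 then [] else pscale (sdot a.2 b.2) (pmul (padj a.1) b.1)))).sum := by
      intro a ha
      have ha1 : a.1 ∈ B.reps := (List.of_mem_zip (by rw [Prod.mk.eta]; exact ha)).1
      exact polyOp_blockRow Λ' B a (hs a.1 ha1) hq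
    rw [List.map_congr_left hrow, list_sum_swap, List.smul_sum, List.map_map]
    congr 1
    refine List.map_congr_left fun m _ => ?_
    unfold gramBlockPolyR
    simp only [Function.comp, movePolyF_pscale, polyOp_pscale, movePolyF_flatMap, polyOp_flatMap]
  -- (2) `Σ_m polyOp (α_m D) = |moves| • polyOp D + Σ uses`
  rw [h1, blockUses, list_sum_map_flatMap, polyOp_pscale]
  have h2 : (B.moves.map fun m => polyOp Λ' (movePolyF m.γ m.v (gramBlockPolyR B))).sum =
      (B.moves.map fun m => polyOp Λ' (gramBlockPolyR B) + ((polyUses m.γ m.v (gramBlockPolyR B)).map (useOp Λ')).sum).sum := by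
    congr 1
    refine List.map_congr_left fun m _ => ?_
    rw [← polyOp_movePolyF_sub]; abel
  rw [h2, List.sum_map_add, list_sum_map_const, Rat.cast_natCast, Nat.cast_smul_eq_nsmul]

/-- Words of `D_B` lie where the representatives and the generated basis lie. -/
theorem PSupp_gramBlockPolyR (B : GramBlockR) {Λ : Finset (Site 2)} (hs : ∀ s ∈ B.reps, PSupp s Λ)
    (hq : ∀ q ∈ genBasis B, PSupp q Λ) : PSupp (gramBlockPolyR B) Λ := by
  unfold gramBlockPolyR
  refine PSupp.pscale _ (PSupp.flatMap _ _ fun a ha => PSupp.flatMap _ _ fun b hb => ?_)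
  have ha' : PSupp a.1 Λ := hs _ (List.of_mem_zip ha).1
  have hb' : PSupp b.1 Λ := hq _ (List.of_mem_zip hb).1
  dsimp only
  split_ifs
  · exact PSupp_nil _
  · exact (ha'.padj.pmul hb').pscale _

/-- The generated basis lies where the pre-collection generator lies. -/
theorem PSupp_genOne {ms : List RMove} {s : QPoly} {Λ : Finset (Site 2)} (h : PSupp (genPre ms s) Λ) :
    PSupp (genOne ms s) Λ := h.nfPoly.collect

end Summit.Ventures.CertifiedManyBodySolver.Theorems.SymReplay

end
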